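/-
Origin: expansion seat `planner-pub-hodgecm-toy2-g2-0`, handover #8 2026-08-18T05:45:41Z (`HOME/pub-hodgecm-toy2-g2/lean/Toy2g2/ToyRetrace.lean`, md5 54e9fafb, 136 lines);
landed by the gen-6 packager in gate run 23 as `HodgeCM/Model/Toy/ToyRetrace.lean` (verbatim).
-/
/-
# No re-tracing of the exterior model satisfies M26 and F6 (CONSISTENCY seat 2, unit `pub-hodgecm-toy2-g2`)

`ToyFFacts` showed that F6 `Fact_weightDual` fails in `toyModelWith D` because its trace is `0`.  The natural
repair — keep every datum of the exterior model and replace ONLY the trace by some family of functionals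
`tr' X k : ⋀ᵏ L X → ℚ` (e.g. the top-degree coefficient, a Berezin integral) — CANNOT work: for EVERY choice
of `tr'`, the re-traced universe `retrace D tr'` satisfies

* `tr_surface_eq_zero` — M26 `Fact_gysin_surface` forces `tr' S 4 = 0` on every object `S` with `rk L_S = 4`
  and no padding (`extra = 0`): map `S` to `X = S × pmsObj` by `f = lift id 0`; `X` is padded
  (`dim X = 4`, `rk L_X = 4`), so `H⁸(X) = ⋀⁸ L_X = 0` and M26 reads `tr_S (f^* y) = tr_X (y ∪ c) = 0`, while
  `f^*` is onto `⋀⁴ L_S` (it has the section `fst^*`);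
* `not_weightDual_of_gysin_surface` — hence `Fact_gysin_surface → ¬ Fact_weightDual`: F6 applied to the CM
  abelian surface `S = A_{(ℚ(ζ₅), Φ)}` (`rk L_S = [ℚ(ζ₅):ℚ] = 4`), degree `0`, weight `∅`, `w = 1`, demands a
  partner `w'` with `tr_S (w' ∪ w) ≠ 0` in degree `4`.

So a model of `ModelAxioms ∧ F6` must change more than the trace: the padded objects (the Picard-modular-surface
placeholder `pmsObj`, `L = 0`, `extra = 2`) need honest top cohomology (e.g. `H^•(A) ⊗ H^•(P^e)`), which changes
`H²`, `H⁴` of every padded object.  This is the formal content of TOY2-G2.md Addendum 6.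
-/
import Mathlib.LinearAlgebra.ExteriorPower.Basis
import Summits.HodgeConjecture.HodgeCM.Model.Toy.CupFacts
import Summits.HodgeConjecture.HodgeCM.Model.Inhabited
import Summits.HodgeConjecture.HodgeCM.StubTree.Qw8Geometric

/-! PORT of `HodgeCM/Model/Toy/ToyRetrace.lean` (HodgeCMPerL run 82) — verbatim mechanical port; provenance in the PORT header line. -/

noncomputable section

namespace HodgeCM.Toy.Retrace

open Literature.AlgebraicGeometry.Motives NumberField
open scoped TensorProduct
open exteriorPower

variable (D : HodgeData)

/-- the exterior model `toyModelWith D` with its trace replaced by an arbitrary family of functionals -/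
def retrace (tr' : (X : Obj) → (k : ℕ) → (↥(⋀[ℚ]^k X.L) →ₗ[ℚ] ℚ)) : Universe :=
  { toyModelWith D with tr := tr' }

variable (tr' : (X : Obj) → (k : ℕ) → (↥(⋀[ℚ]^k X.L) →ₗ[ℚ] ℚ))

/-- (Ported verbatim from the HodgeCMPerL package; no docstring in the source.) -/
lemma tr_retrace (X : Obj) (k : ℕ) : (retrace D tr').tr X k = tr' X k := rfl
/-- (Ported verbatim from the HodgeCMPerL package; no docstring in the source.) -/
lemma pull_retrace {X Y : Obj} (f : Obj.Hom X Y) (k : ℕ) :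
    (retrace D tr').pull (X := X) (Y := Y) f k = map k f.lin := rfl
/-- (Ported verbatim from the HodgeCMPerL package; no docstring in the source.) -/
lemma dim_retrace (X : Obj) : (retrace D tr').dim X = Module.finrank ℚ X.L / 2 + X.extra := rfl

/-- the zero morphism `S → pmsObj` (`L pmsObj = 0`, so the Hodge condition is vacuous) -/
def toPms (S : Obj) : Obj.Hom S pmsObj := ⟨0, (Obj.isHodge_iff _).mpr fun i => i.elim⟩

/-! ### M26 kills the trace of every unpadded object of rank 4 -/

/-- **M26 ⇒ `tr' S 4 = 0`** for every `S` with `rk L_S = 4`, `extra S = 0`. -/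
theorem tr_surface_eq_zero (h26 : (retrace D tr').Fact_gysin_surface) (S : Obj)
    (hrk : Module.finrank ℚ S.L = 4) (hex : S.extra = 0) (v : ↥(⋀[ℚ]^4 S.L)) : tr' S 4 v = 0 := by
  let X : Obj := S.prod pmsObj
  let f : Obj.Hom S X := Obj.lift (Obj.Hom.id S) (toPms S)
  have hS : (retrace D tr').dim S = 2 := by rw [dim_retrace, hrk, hex]
  obtain ⟨c, -, hc⟩ := h26 S X f hS
  haveI : Module.Free ℚ S.L := Module.Free.of_divisionRing ℚ _
  haveI : Module.Free ℚ pmsObj.L := Module.Free.of_divisionRing ℚ _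
  have hXrk : Module.finrank ℚ X.L = 4 := by
    rw [(S.sumEquiv pmsObj).finrank_eq, Module.finrank_prod, finrank_L_pmsObj, hrk]
  haveI : Module.Finite ℚ X.L := Module.finite_of_finrank_eq_succ hXrk
  haveI : Module.Free ℚ X.L := Module.Free.of_divisionRing ℚ _
  have hXdim : (retrace D tr').dim X = 4 := by
    rw [dim_retrace, hXrk]; change 4 / 2 + (S.extra + 2) = 4; rw [hex]
  -- `H^{4 + 2 (dim X - 2)}(X) = ⋀⁸ L_X = 0`
  have hzero : ∀ z : (retrace D tr').Coh X (4 + 2 * ((retrace D tr').dim X - 2)), z = 0 := by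
    rw [hXdim]
    change ∀ z : ↥(⋀[ℚ]^(4 + 2 * (4 - 2)) X.L), z = 0
    rw [← finrank_zero_iff_forall_zero (K := ℚ), exteriorPower.finrank_eq, hXrk]
    decide
  -- `f^*` has the section `fst^*`
  have hsec : f.lin ∘ₗ S.inlL pmsObj = LinearMap.id :=
    congrArg Obj.Hom.lin (Obj.lift_comp_fst (Obj.Hom.id S) (toPms S))
  have hv : v = map 4 f.lin (map 4 (S.inlL pmsObj) v) := by
    rw [← LinearMap.comp_apply (map 4 f.lin), ← map_comp, hsec, map_id, LinearMap.id_apply]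
  have key : tr' S 4 (map 4 f.lin (map 4 (S.inlL pmsObj) v)) =
      tr' X _ ((retrace D tr').cup X 4 _ (map 4 (S.inlL pmsObj) v) c) := hc (map 4 (S.inlL pmsObj) v)
  rw [hv, key, hzero ((retrace D tr').cup X 4 _ (map 4 (S.inlL pmsObj) v) c)]
  exact LinearMap.map_zero _

/-! ### The fifth cyclotomic field: a CM field of degree 4 -/

set_option backward.isDefEq.respectTransparency false in
/-- (Ported verbatim from the HodgeCMPerL package; no docstring in the source.) -/
instance cyclotomicField5_isCMField : IsCMField (CyclotomicField 5 ℚ) :=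
  IsCyclotomicExtension.Rat.isCMField (CyclotomicField 5 ℚ) (S := ({5} : Set ℕ))
    ⟨5, Set.mem_singleton 5, by norm_num⟩

/-- `ℚ(ζ₅)` as a bundled CM field. -/
def cyclo5 : CMField := ⟨CyclotomicField 5 ℚ⟩

set_option backward.isDefEq.respectTransparency false in
/-- (Ported verbatim from the HodgeCMPerL package; no docstring in the source.) -/
theorem cyclo5_finrank : Module.finrank ℚ cyclo5 = 4 := by
  have h := IsCyclotomicExtension.finrank (n := 5) (K := ℚ) (CyclotomicField 5 ℚ)
    (Polynomial.cyclotomic.irreducible_rat (by norm_num))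
  rw [Nat.totient_prime (by norm_num : Nat.Prime 5)] at h
  exact h

/-! ### F6 is unreachable by re-tracing -/

/-- **No re-tracing of the exterior model satisfies M26 and F6.** -/
theorem not_weightDual_of_gysin_surface (h26 : (retrace D tr').Fact_gysin_surface) :
    ¬ (retrace D tr').Fact_weightDual := by
  intro h6
  let Θ : Fin (0 + 1) → CMType cyclo5 := fun _ => stdCMType cyclo5
  -- `S = cmProd ℚ(ζ₅) Θ = cmObj ℚ(ζ₅) (Θ 0)`: rank 4, no padding
  have hrk : Module.finrank ℚ ((retrace D tr').cmProd cyclo5 Θ).L = 4 := by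
    change Module.finrank ℚ (cmObj cyclo5 (Θ 0)).L = 4
    rw [finrank_L_cmObj, cyclo5_finrank]
  have hex : ((retrace D tr').cmProd cyclo5 Θ).extra = 0 := rfl
  have hdim : (retrace D tr').dim ((retrace D tr').cmProd cyclo5 Θ) = 2 := by
    rw [dim_retrace, hrk, hex]
  -- the weight vector `w = 1 ⊗ 1 ∈ ℂ ⊗ ⋀⁰ L` of weight `∅`
  let b : Module.Basis Unit ℚ ↥(⋀[ℚ]^0 ((retrace D tr').cmProd cyclo5 Θ).L) :=
    (Module.Basis.singleton Unit ℚ).map (exteriorPower.zeroEquiv ℚ _).symm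
  let w : (retrace D tr').CohC ((retrace D tr').cmProd cyclo5 Θ) (2 * 0) := Algebra.TensorProduct.basis ℂ b ()
  have hw : w ≠ 0 := (Algebra.TensorProduct.basis ℂ b).ne_zero ()
  have hW : (retrace D tr').IsWeightVector cyclo5 Θ (fun _ => ∅) (2 * 0) w := by
    intro j a M _
    rw [Finset.prod_empty, one_smul, Universe.pullC,
      show (retrace D tr').pull M (2 * 0) = LinearMap.id from fact_pull_H0 D _ M, LinearMap.baseChange_id,
      LinearMap.id_apply]
  obtain ⟨-, w', -, h1, -⟩ := h6 cyclo5 0 Θ 0 (fun _ => ∅) w hw hW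
  have hn : 2 * ((retrace D tr').dim ((retrace D tr').cmProd cyclo5 Θ) - 0) + 2 * 0 = 4 := by rw [hdim]
  have key : ∀ n, n = 4 → (retrace D tr').tr ((retrace D tr').cmProd cyclo5 Θ) n = 0 := by
    rintro n rfl
    exact LinearMap.ext fun v => tr_surface_eq_zero D tr' h26 _ hrk hex v
  exact h1 (by rw [Universe.trC, key _ hn, LinearMap.baseChange_zero, LinearMap.comp_zero, LinearMap.zero_apply])

/-- Corollary: no re-tracing of the exterior model is a model of `ModelAxioms ∧ F6`. -/
theorem not_modelAxioms_and_weightDual :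
    ¬ ((retrace D tr').ModelAxioms ∧ (retrace D tr').Fact_weightDual) :=
  fun h => not_weightDual_of_gysin_surface D tr' h.1.gysin_surface h.2

end HodgeCM.Toy.Retrace
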